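import Literature.Analysis.FluidPDE.LerayHopf
import Literature.Analysis.FunctionSpaces.TorusSpaceTime
import HarnessLib

/-!
# Barrier: instantaneous Type-I blow-up and non-uniqueness of spatially smooth weak solutions
# from ARBITRARY smooth data (Cheskidov–Dai–Palasek 2025)

Barrier catalogue entry for `NavierStokesRegularity` (D-0021), non-uniqueness family. Vendors,
as ONE named fact over the accepted torus vocabulary
(`Literature.Analysis.FunctionSpaces.Torus.IsWeakNSSolutionWithDataOn`,
`Literature.Analysis.FunctionSpaces.Torus.IsClassicalNSSolutionOn`,
`Literature.Analysis.FunctionSpaces.Torus.IsSmooth`, `Literature.Analysis.FunctionSpaces.Torus.IsDivFree`,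
`Literature.Analysis.FunctionSpaces.Torus.fderiv`, `Literature.Analysis.FluidPDE.Torus.MemLqLp`),
Theorem 1.1 (with Remarks 1.2–1.3) of A. Cheskidov, M. Dai, S. Palasek, *Instantaneous Type I
blow-up and non-uniqueness of smooth solutions of the Navier–Stokes equations*, arXiv:2511.09556
(2025), and PROVES from it the announced consequences "failure of uniqueness and even weak–strong
uniqueness of the initial value problem" (§1, p. 2) in the formal class of the rendering.
Nearest catalogue entries: `CriticalDataSmoothNonuniqueness` (Coiculescu–Palasek 2025: two global
smooth solutions from one ROUGH critical datum) and `SharpLpLinftyNonuniqueness` (Cheskidov–Luo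
2022: non-uniqueness in `L^p_t L^∞_x`, `p < 2`, by convex integration). Here the datum is an
arbitrary SMOOTH divergence-free field, every solution is `C^∞(𝕋^d)` at EVERY time, and the
engine is a complete inverse energy cascade realised by a classical flow, not convex integration.

## What is printed (numbering of the held copy, arXiv:2511.09556)

* §1, setting: (NSE) `∂ₜu − νΔu + div(u ⊗ u) + ∇p = 0`, `div u = 0` on `𝕋^d × [0,T]`, `d ≥ 2`,
  `ν` "typically normalize[d] to `1` without loss of generality"; "a solution `(u,p)` of (NSE) is
  classical if it is smooth on `𝕋^d × [0,T]` in space and time". Def. 2.1 (weak solution with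
  datum `u₀ ∈ L²` weakly divergence free; `𝒟_T` = smooth divergence-free `φ` on `𝕋^d × ℝ` with
  `φ = 0` for `t ≥ T`): `u ∈ L²(𝕋^d × [0,T])`, weakly divergence free for a.e. `t`, and
  `∫ u₀·φ(·,0) = −∫₀ᵀ∫ u·(∂ₜφ + Δφ + u·∇φ)` for all `φ ∈ 𝒟_T` (the definition of Cheskidov–Luo,
  rendered in the sibling `SharpLpLinftyNonuniqueness` by the same accepted predicate).
* **Thm. 1.1.** "For any `d ≥ 2` and `u₀ ∈ C^∞(𝕋^d)` divergence-free, there exists `T > 0` such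
  that the following holds. For any `T_* ∈ [0,T)`, there exists a weak solution `u(t)` of (NSE) on
  `𝕋^d × [0,T]` such that: (1) For `t ∈ [0,T_*]`, `u` is a classical solution of (NSE) with
  initial data `u(0) = u₀`, (2) For `t ∈ (T_*,T]`, `u` is a classical solution of (NSE) such that,
  for some `c > 0`, `‖u(tₙ)‖_{L^∞} ≥ c/√(tₙ − T_*)`, `‖∇∧u(tₙ)‖_{L^∞} ≥ c/(tₙ − T_*)` along a
  sequence of times `tₙ → T_*+`, (3) The solution `u(t)` is weak-* continuous in time with values
  in `BMO⁻¹`, (4) The blow-up is of Type I: `‖u(t)‖_{L^∞} ≤ C/√(t − T_*)`,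
  `‖∇u(t)‖_{L^∞} ≤ C/(t − T_*)` for all `t ∈ (T_*,T]` and some constant `C > 0`. When `d ≥ 3`, we
  additionally have `u ∈ L^∞_t Ẇ^{-1,∞}_x`, (5) The solution obeys the logarithmically-weakened
  Ladyzhenskaya–Prodi–Serrin bound `∫₀ᵀ ‖u(t)‖²_∞ / (1 + (log log(e + ‖u(t)‖_∞))^c) dt < ∞` and
  Beale–Kato–Majda condition `∫₀ᵀ ‖∇u(t)‖_∞ / (1 + (log log(e + ‖∇u(t)‖_∞))^c) dt < ∞` for some
  `c > 0`. Moreover, (6) `u ∈ L²([0,T]; L^p)` for all `p < ∞`."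
* Rmk. 1.2: "the solution `u(t) ∈ C^∞(𝕋^d)` for every `t ∈ [0,T]`, including at the blow-up
  time"; analytic in space and time away from `t = T_*`. Rmk. 1.3: "(4)–(5) establish that the
  solution is at the borderline of the known regularity criterion `L²_t L^∞_x`"; the Orlicz
  weight may be any `f ↑ ∞`; forward self-similar solutions "saturate the Type I bound at every
  time and therefore cannot possibly obey slightly supercritical spacetime estimates of this
  form". Rmk. 1.4: `T` can be any `T < T^{u₀}` (classical lifespan). Rmk. 1.5: "does not appear to
  have been identified before".
* §1, p. 2: "If a smooth solution … undergoes an instantaneous blow-up at `t = T_*` …, failure of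
  uniqueness and even weak–strong uniqueness of the initial value problem directly follow … `u`
  and `U` must be distinct after `T_*`"; "the solutions … lie arbitrarily close to known criteria
  for uniqueness and weak–strong uniqueness"; "many of the critical regularity criteria (for
  instance, Ladyzhenskaya–Prodi–Serrin and Onsager-type ones) that are well-known to prevent
  finite-time blow-up also prevent instantaneous blow-up … the time asymmetry at the heart of the
  construction is from not the Laplacian, but the nonlinearity".
* **Thm. 1.6** (`U` any classical solution on `𝕋^d × [0,T]`, `T ≤ 1`): for any `T_* ∈ [0,T)` a
  family `(u^{(σ)})_{σ ∈ [0,1]}` of weak solutions on `ℝ^d × [0,T]`, `u^{(0)} = U`,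
  `u^{(σ)} = U` on `[0,T_*]`, `u^{(σ)} ≢ U` on `(T_*,T]` for `σ ∈ (0,1]`, `u^{(σ)}(t) ∈ C^∞(ℝ^d)`
  for all `t`, `u^{(σ)} ∈ L^{2,∞}_t L^∞_x ∩ L²_t L^p_{x,loc}` (`p < ∞`), `L^∞_t Ẇ^{-1,∞}_x` for
  `d ≥ 3`; along `σₙ → 0+` the solutions are `2π`-periodic and converge weak-* in `BMO⁻¹(𝕋^d)` to
  `U` (Rmk. 1.7: quasi-periodicity, spontaneous breaking of periodicity; Rmk. 1.8: Koch–Tataru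
  path space `X_{[T_*,T]}`, `L^∞_t BMO⁻¹_x`).
* §1.2: "for general weak solutions, an instantaneous blow-up can occur from an arbitrary
  classical solution … While there are numerous regularity conditions precluding a finite-time
  blow-up, the analogous problem for instantaneous blow-up does not appear to have been
  considered"; "an instantaneous blow-up can occur in the Leray–Hopf class only after the
  appearance of a finite-time blow-up"; "instantaneous blow-up is a fundamentally nonlinear
  phenomenon" (the heat flow from `Ḃ^{-1}_{∞,∞}` data obeys the Type-I bound but blows up from the
  right only for singular data).
* §1.3: near an isolated blow-up time the Type-I bounds are "essentially equivalent to the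
  inclusion `u ∈ L^{2,∞}_t L^∞_x`, which should be compared to the Ladyzhenskaya–Prodi–Serrin
  space `L²_t L^∞_x`"; finite-time Type-I blow-up for `d ≥ 3` is "a major open question".
* §1.5, **Thm. 1.10** (Fabes–Jones–Rivière …, Cheskidov–Luo): a weak solution with `u(0) = U(0)`,
  `U` classical on `[0,T]`, and `u ∈ L²_t L^∞_x([0,T] × 𝕋^d)` equals `U`; **Thm. 1.11**: with
  `u(0) = 0`, `u ∈ L²_t Ḣ¹ ∩ L^∞_t B^{-1}_{∞,∞}` or `u ∈ L^∞_t L² ∩ L²_t Ḣ¹ ∩ L^{2,∞}_t L^∞_x`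
  forces `u ≡ 0`.
* §1.6: the solutions "exhibit a strong inverse energy cascade at time `t = T_*`":
  `lim_N Π_N([T_*,t]) = ∞`, `lim_N Π_N([t,T]) = 0`; for classical solutions and for the Onsager
  class `L³_t B^{1/3}_{3,c₀}` the flux vanishes. §1.7 / §§3–5: `u = U + v + w`, `v` an explicit
  multi-scale series of Fourier-localised blocks at double-exponentially separated frequencies
  `N_{j,k}` in which level `k+1` generates level `k` on `[t_{k+1}, t_k]` (inverse cascade), `w` a
  slightly subcritical corrector from a fixed point in a Koch–Tataru-type space (Prop. 5.3);
  Lemma 6.1 (classical on `[0,T_*)` and on `(T_*,T]`, `L²_{t,x} ∩ L^∞_t H^s_x`, continuous in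
  `𝒟'` at `T_*` ⟹ weak solution on `[0,T]`); Prop. 6.2 (the borderline classes).

## Rendering (scope of the Lean text; weaker than print, implied by it)

* The `2π`-periodic setting is transported to `UnitAddTorus (Fin n)` by the Navier–Stokes scaling
  `x ↦ 2πx`, `t ↦ 4π²t` (keeps `ν = 1`; smooth divergence-free data correspond bijectively, the
  conclusions (1)–(6) keep their form with rescaled constants, all of which are existential).
* "weak solution on `𝕋^d × [0,T]` with datum `u₀`" (Def. 2.1) is the accepted
  `Torus.IsWeakNSSolutionWithDataOn T 1 u₀ u` — the same identity; the accepted predicate tests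
  against smooth divergence-free fields vanishing on some `[T',∞)`, `T' < T`, a subclass of `𝒟_T`,
  so on the conclusion side this only weakens.
* (1): `u 0 = u₀` and, for `T_* > 0`, a classical solution (accepted structure, smooth pressure)
  on the time set `Icc 0 T_*`; for `T_* = 0` print's (1) is just the datum (a "classical solution
  on `[0,0]`" carries no equation), whence the guard `0 < T_*`. (2): classical on `Ioc T_* T`; the
  lower bound is rendered for `‖u(tₙ)‖_∞` only (`∃ x, c/√(tₙ − T_*) ≤ ‖u(tₙ,x)‖`, the sup of the
  continuous slice being attained), along `tₙ → T_*`, `tₙ ∈ (T_*,T]`; the vorticity lower bound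
  `‖∇∧u(tₙ)‖_∞ ≥ c/(tₙ − T_*)` is print-only. Rmk. 1.2: `Torus.IsSmooth (u t)` for every
  `t ∈ [0,T]`. (4): pointwise `‖u(t,x)‖ ≤ C/√(t − T_*)` and `‖D u(t)(x)‖ ≤ C/(t − T_*)` with the
  operator norm of the accepted spatial derivative `Torus.fderiv` (any two matrix norms differ by
  dimensional constants, absorbed in the existential `C`). (5): with `‖u(t)‖_∞ := ⨆ₓ ‖u(t,x)‖`,
  `‖∇u(t)‖_∞ := ⨆ₓ ‖D u(t)(x)‖` (genuine suprema of continuous functions at every `t ∈ [0,T]`),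
  integrability on `(0,T)` of the two printed Orlicz-weighted quantities, each for SOME `c > 0`
  (print: "for some `c > 0`" once; separate constants only weaken); the monotone weight makes the
  second condition insensitive to the choice of matrix norm. (6): `Torus.MemLqLp 2 p u (Ioo 0 T)`
  for every real `p ≥ 1`. Print-only (no accepted vocabulary): (3) weak-* continuity in `BMO⁻¹`,
  `L^∞_t Ẇ^{-1,∞}_x` (`d ≥ 3`), `L^{2,∞}_t L^∞_x`, Rmk. 1.4, and all of Thm. 1.6 (`ℝ^d`,
  quasi-periodic family; its `2π`-periodic members are, on `𝕋^d`, further weak solutions of the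
  kind produced by Thm. 1.1).

## References

* A. Cheskidov, M. Dai, S. Palasek, arXiv:2511.09556 (2025). [`CheskidovDaiPalasek2025`]
* A. Cheskidov, X. Luo, Invent. Math. 229 (2022) (Thm. 1.10 here = their endpoint uniqueness;
  in-tree `Literature.Barriers.NavierStokesRegularity.SharpLpLinftyNonuniqueness`). [`CheskidovLuo2022`]
* M. P. Coiculescu, S. Palasek, Invent. Math. 244 (2025) (in-tree
  `Literature.Barriers.NavierStokesRegularity.CriticalDataSmoothNonuniqueness`). [`CoiculescuPalasek2025`]
* in-tree, `ℝ³`, Leray–Hopf class: `Literature.Analysis.FluidPDE.ladyzhenskaya_prodi_serrin`,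
  `Literature.Analysis.FluidPDE.weak_strong_uniqueness` (ns.S07), `Literature.Analysis.FluidPDE.beale_kato_majda`.
-/

noncomputable section

open MeasureTheory Set Filter Topology
open scoped ENNReal

namespace Literature.Barriers.NavierStokesRegularity

/-- Local notation: the flat `n`-torus `𝕋ⁿ = (ℝ/ℤ)ⁿ`. -/
local notation "𝕋^" n => UnitAddTorus (Fin n)
/-- Local notation: the value space `ℝⁿ`. -/
local notation "ℝ^" n => EuclideanSpace ℝ (Fin n)

/-- **Barrier (Cheskidov–Dai–Palasek 2025, Thm. 1.1 with Rmks. 1.2–1.3): smooth instantaneous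
Type-I blow-up from ARBITRARY smooth data, in every dimension `d ≥ 2`.** For `n ≥ 2` and every
smooth divergence-free `u₀` on `𝕋ⁿ` there is `T > 0` such that for every `T_* ∈ [0,T)` there is a
weak solution `u` of the unforced Navier–Stokes equations (viscosity `1`) on `𝕋ⁿ × [0,T]` with
datum `u₀` (accepted `Torus.IsWeakNSSolutionWithDataOn`) such that: `u(0) = u₀`; for `T_* > 0`,
`u` is a classical solution on `[0,T_*]` (accepted `Torus.IsClassicalNSSolutionOn (Icc 0 T_*)`,
some smooth pressure); `u` is a classical solution on `(T_*,T]`; `u(t)` is smooth on `𝕋ⁿ` for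
EVERY `t ∈ [0,T]` (Rmk. 1.2, including `t = T_*`); blow-up from the right: for some `c > 0` and
some sequence `tₖ ∈ (T_*,T]`, `tₖ → T_*`, `‖u(tₖ)‖_∞ ≥ c/√(tₖ − T_*)`; Type I:
`‖u(t,x)‖ ≤ C/√(t − T_*)` and `‖Du(t)(x)‖ ≤ C/(t − T_*)` on `(T_*,T] × 𝕋ⁿ`; the log-log-weakened
Ladyzhenskaya–Prodi–Serrin and Beale–Kato–Majda integrals
`∫₀ᵀ ‖u‖²_∞/(1 + (log log(e + ‖u‖_∞))^c)`, `∫₀ᵀ ‖Du‖_∞/(1 + (log log(e + ‖Du‖_∞))^c)` are finite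
for some `c > 0`; and `u ∈ L²(0,T; L^p(𝕋ⁿ))` for every `p < ∞`. Print has moreover the vorticity
lower bound, weak-* continuity in `BMO⁻¹`, `u ∈ L^∞_t Ẇ^{-1,∞}_x` (`d ≥ 3`) and
`u ∈ L^{2,∞}_t L^∞_x` (module docstring, *Rendering*).
[cite: CheskidovDaiPalasek2025, Thm. 1.1, Rmks. 1.2–1.3]

BARRIER (structured block, D-0021):
technique_class: weak-solution-uniqueness-criteria weak-strong-uniqueness-from-smooth-data borderline-LPS-uniqueness orlicz-weakened-prodi-serrin lorentz-in-time-LPS log-weakened-beale-kato-majda spatial-smoothness-selection type-I-class-regularity bmo-inverse-class-regularity smooth-data-short-time-persistence-for-weak-solutions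
blocks: (i) uniqueness, and even weak–strong uniqueness against the classical solution, of weak solutions (Def. 2.1) of the Cauchy problem on `𝕋^d`, `d ≥ 2`, from SMOOTH data, in every class containing the solutions of Thm. 1.1 — classical off one instant, `C^∞(𝕋^d)` at every time, Type-I bounded, in `L²_t L^p_x` for all `p < ∞`, obeying every `f`-weakened Ladyzhenskaya–Prodi–Serrin / Beale–Kato–Majda space–time bound with `f ↑ ∞` (and, in print, in `L^{2,∞}_t L^∞_x`, `L^∞_t BMO⁻¹_x`, `L^∞_t Ẇ^{-1,∞}_x` for `d ≥ 3`): "failure of uniqueness and even weak–strong uniqueness of the initial value problem directly follow", the solutions "lie arbitrarily close to known criteria for uniqueness and weak–strong uniqueness" [cite: CheskidovDaiPalasek2025, §1 (p. 2), Thm. 1.1, Rmk. 1.3] — proved below in the formal class as `InstantaneousTypeIBlowup.exists_two` / `.not_unique` / `.not_weak_strong_unique`; hence no strengthening of the endpoint uniqueness class `L²_t L^∞_x` [cite: CheskidovDaiPalasek2025, Thm. 1.10] [cite: CheskidovLuo2022, Thm. 1.3] (in-tree, `ℝ³`, Leray–Hopf: `Literature.Analysis.FluidPDE.weak_strong_uniqueness`,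 `Literature.Analysis.FluidPDE.ladyzhenskaya_prodi_serrin`) to an Orlicz class `∫ ‖u‖²_∞/(1+f(‖u‖_∞)) < ∞`, `f ↑ ∞`, or to weak-`L²` in time, can serve as a uniqueness or regularity criterion for weak solutions on `𝕋^d` [cite: CheskidovDaiPalasek2025, Rmk. 1.3 and §1.3]; (ii) "smooth data ⟹ the weak solution stays smooth / bounded for a short time" for weak solutions that are `C^∞(𝕋^d)` at the initial instant: an instantaneous blow-up "can appear for any smooth divergence-free initial data, and in any spatial dimension `d ≥ 2`", "for general weak solutions, an instantaneous blow-up can occur from an arbitrary classical solution" [cite: CheskidovDaiPalasek2025, §1 and §1.2]; (iii) boundedness / regularity criteria for weak solutions from smooth data phrased through the Type-I rate `‖u(t)‖_∞ ≲ |t − T_*|^{-1/2}` or (in print, `d ≥ 3`) through `u ∈ L^∞_t BMO⁻¹_x`, `u ∈ L^∞_t Ẇ^{-1,∞}_x` alone: these classes contain solutions with a blow-up time — "Under this definition, the instantaneous blow-up constructed here is still of Type I, in that the solution is in `L^∞_t Ẇ^{-1,∞}_x` or `L^∞_t BMO⁻¹_x`" — while FORWARD (finite-time) Type-I blow-up for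 `d ≥ 3` "is a major open question" [cite: CheskidovDaiPalasek2025, Thm. 1.1 (4) and §1.3].
because: a complete inverse energy cascade realised by a classical Navier–Stokes flow: writing the blow-up time as `t = 0`, `u = U + v + w` where the principal part `v = Σ_k v_k` is an explicit series of Fourier-localised oscillatory blocks at double-exponentially separated frequencies `N_{j,k}` whose level-`(k+1)` self-interactions generate level `k` on a short interval `[t_{k+1}, t_k]`, `t_k ↓ 0` ("transferring energy down the frequency ladder"), the residual stress being small in a critical sense, and `w` is a slightly subcritical corrector obtained by a fixed point in a Koch–Tataru-type space [cite: CheskidovDaiPalasek2025, §1.7, §§3–5, Prop. 5.3]; the energy enters "at infinite wavenumber" at `t = T_*`: `lim_N Π_N([T_*,t]) = ∞` while `lim_N Π_N([t,T]) = 0` [cite: CheskidovDaiPalasek2025, §1.6]; the field is classical on both sides of `T_*` and continuous in `𝒟'` there, which makes it a weak solution across `T_*` [cite: CheskidovDaiPalasek2025, Lemma 6.1], and the borderline memberships are Prop. 6.2; "the time asymmetry at the heart of the construction is from not the Laplacian, but the nonlinearity … nonlocal interactions in frequency space are most robust from high to low frequencies forwards in time" [cite: CheskidovDaiPalasek2025,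 §1].
evasions_known: (a) the endpoint Ladyzhenskaya–Prodi–Serrin class itself: a weak solution with the classical datum and `u ∈ L²_t L^∞_x([0,T] × 𝕋^d)` coincides with the classical solution [cite: CheskidovDaiPalasek2025, Thm. 1.10] [cite: CheskidovLuo2022, Thm. 1.3]; (b) energy-class (time-chiral) hypotheses: for `u(0) = 0`, `u ∈ L²_t Ḣ¹ ∩ L^∞_t B^{-1}_{∞,∞}` or `u ∈ L^∞_t L² ∩ L²_t Ḣ¹ ∩ L^{2,∞}_t L^∞_x` forces `u ≡ 0` [cite: CheskidovDaiPalasek2025, Thm. 1.11]; more generally the Leray–Hopf energy inequality: "an instantaneous blow-up can occur in the Leray–Hopf class only after the appearance of a finite-time blow-up", i.e. never from a classical solution, by weak–strong uniqueness [cite: CheskidovDaiPalasek2025, §1.2] (in-tree `Literature.Analysis.FluidPDE.weak_strong_uniqueness`, `ℝ³`); (c) classical / Onsager-class solutions have vanishing energy flux `lim_N Π_N = 0` and the energy equality, which excludes the cascade [cite: CheskidovDaiPalasek2025, §1.6]; (d) the blow-up is NOT a finite-time (forward) blow-up and produces no spatial singularity: "for weakly continuous solutions, a formation of singularity in space requires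 a blow-up from the left" [cite: CheskidovDaiPalasek2025, §1.2].
scope_caveats: (i) a statement about weak solutions in the sense of Def. 2.1 (`L²_{t,x}`, no energy inequality) on the periodic box, `ν = 1`, no force [cite: CheskidovDaiPalasek2025, §1 and Def. 2.1]: the solutions gain energy at `T_*` and are not Leray–Hopf, so NOTHING is asserted about uniqueness of Leray–Hopf / suitable solutions (`Literature.Analysis.FluidPDE.LerayHopfNonUniqueness` stays open) nor about the summit's smooth solutions on `ℝ³`, which are unique while they exist — the result exhibits non-uniqueness BESIDE the classical solution, not blow-up OF it [cite: CheskidovDaiPalasek2025, §1.2]; (ii) it is an instantaneous (backward-in-time, "blow-up from the right") singularity of the `L^∞` norm with `u(T_*) ∈ C^∞`: no finite-time blow-up `lim_{t → T_*−} ‖u(t)‖_∞ = ∞` of a classical solution is produced, which for `d ≥ 3` remains open, as does forward Type-I blow-up [cite: CheskidovDaiPalasek2025, §1 and §1.3]; (iii) printed on `𝕋^d` (`2π`-periodic) — Thm. 1.6's family lives on `ℝ^d` and is only quasi-periodic for generic `σ`; decaying solutions on `ℝ^d` or a periodic family on `𝕋^d` are "very likely" but not pursued [cite: CheskidovDaiPalasek2025,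 Rmk. 1.7]; (iv) the Lean rendering is WEAKER than print (see *Rendering*): `T_* = 0` keeps only the datum in (1); the vorticity lower bound, `BMO⁻¹` weak-* continuity, `L^∞_t Ẇ^{-1,∞}_x`, `L^{2,∞}_t L^∞_x`, Rmk. 1.4 (`T` up to the classical lifespan) and Thm. 1.6 (continuum of solutions, weak-* convergence to `U`) are print-only, the test class of the accepted weak formulation is a subclass of `𝒟_T`, the `2π`-torus is transported to the unit torus by scaling, and `‖∇u‖_∞` is rendered with the operator norm of `Torus.fderiv` (constants are existential); so the FORMAL non-uniqueness (`.not_unique`) is established in the class "weak solution with datum `u₀`, `C^∞(𝕋ⁿ)` at every time (and all of (1)–(6) as rendered)", while "borderline of `L²_t L^∞_x` in the `BMO⁻¹`/Lorentz sense" is carried by the citation; (v) `T > 0` depends on `u₀` (existential; print: any `T` below the classical lifespan, Rmk. 1.4).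
status: established (arXiv preprint 2025, complete proofs; not yet refereed at the time of vendoring) -/
def InstantaneousTypeIBlowup : Prop :=
  ∀ (n : ℕ), 2 ≤ n → ∀ u₀ : (𝕋^n) → ℝ^n,
    Literature.Analysis.FunctionSpaces.Torus.IsSmooth u₀ →
    Literature.Analysis.FunctionSpaces.Torus.IsDivFree u₀ →
    ∃ T : ℝ, 0 < T ∧ ∀ Ts : ℝ, 0 ≤ Ts → Ts < T →
      ∃ u : ℝ → (𝕋^n) → ℝ^n,
        Literature.Analysis.FunctionSpaces.Torus.IsWeakNSSolutionWithDataOn T 1 u₀ u ∧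
        u 0 = u₀ ∧
        (0 < Ts → ∃ p : ℝ → (𝕋^n) → ℝ,
          Literature.Analysis.FunctionSpaces.Torus.IsClassicalNSSolutionOn (Icc 0 Ts) 1 0 u p) ∧
        (∃ q : ℝ → (𝕋^n) → ℝ,
          Literature.Analysis.FunctionSpaces.Torus.IsClassicalNSSolutionOn (Ioc Ts T) 1 0 u q) ∧
        (∀ t ∈ Icc 0 T, Literature.Analysis.FunctionSpaces.Torus.IsSmooth (u t)) ∧
        (∃ c : ℝ, 0 < c ∧ ∃ s : ℕ → ℝ, (∀ k, Ts < s k ∧ s k ≤ T) ∧ Tendsto s atTop (𝓝 Ts) ∧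
          ∀ k, ∃ x, c / Real.sqrt (s k - Ts) ≤ ‖u (s k) x‖) ∧
        (∃ C : ℝ, ∀ t ∈ Ioc Ts T, ∀ x, ‖u t x‖ ≤ C / Real.sqrt (t - Ts) ∧
          ‖Literature.Analysis.FunctionSpaces.Torus.fderiv (u t) x‖ ≤ C / (t - Ts)) ∧
        (∃ c : ℝ, 0 < c ∧ IntegrableOn (fun t : ℝ => (⨆ x, ‖u t x‖) ^ 2 /
          (1 + Real.log (Real.log (Real.exp 1 + ⨆ x, ‖u t x‖)) ^ c)) (Ioo 0 T)) ∧
        (∃ c : ℝ, 0 < c ∧ IntegrableOn (fun t : ℝ =>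
          (⨆ x, ‖Literature.Analysis.FunctionSpaces.Torus.fderiv (u t) x‖) /
          (1 + Real.log (Real.log (Real.exp 1 +
            ⨆ x, ‖Literature.Analysis.FunctionSpaces.Torus.fderiv (u t) x‖)) ^ c)) (Ioo 0 T)) ∧
        (∀ p : ℝ, 1 ≤ p → Literature.Analysis.FluidPDE.Torus.MemLqLp 2 (ENNReal.ofReal p) u (Ioo 0 T))

/-! ### Proved consequences: non-uniqueness and failure of weak–strong uniqueness in the formal class -/

variable {n : ℕ}

/-- A classical solution on `[0,τ]` (accepted structure) is bounded on `[0,τ] × 𝕋ⁿ` (joint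
smoothness and compactness). [folklore] -/
theorem exists_bound_of_isClassicalNSSolutionOn_Icc {τ : ℝ} {u : ℝ → (𝕋^n) → ℝ^n}
    {p : ℝ → (𝕋^n) → ℝ}
    (h : Literature.Analysis.FunctionSpaces.Torus.IsClassicalNSSolutionOn (Icc 0 τ) 1 0 u p) :
    ∃ C : ℝ, ∀ t ∈ Icc 0 τ, ∀ x, ‖u t x‖ ≤ C :=
  h.smooth_velocity.exists_norm_le_of_isCompact isCompact_Icc subset_rfl

/-- **Blow-up from the right beats any bound.** If `‖u(tₖ, xₖ)‖ ≥ c/√(tₖ − T_*)` with `c > 0`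
along `tₖ → T_*`, `tₖ > T_*`, then for every `C` and every `δ > 0` some `tₖ < T_* + δ` has
`‖u(tₖ, xₖ)‖ > C`. [folklore] -/
theorem exists_lt_and_lt_norm_of_rightBlowup {Ts c : ℝ} (hc : 0 < c) {u : ℝ → (𝕋^n) → ℝ^n} {s : ℕ → ℝ}
    (hs : ∀ k, Ts < s k) (hlim : Tendsto s atTop (𝓝 Ts))
    (hlow : ∀ k, ∃ x, c / Real.sqrt (s k - Ts) ≤ ‖u (s k) x‖) (C δ : ℝ) (hδ : 0 < δ) :
    ∃ k, s k < Ts + δ ∧ ∃ x, C < ‖u (s k) x‖ := by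
  -- a threshold `η > 0` with `c / √η' > |C| + 1` whenever `0 < η' < η`
  set η : ℝ := min δ ((c / (|C| + 1)) ^ 2) with hη
  have hC1 : 0 < |C| + 1 := by positivity
  have hηpos : 0 < η := lt_min hδ (by positivity)
  have hev : ∀ᶠ k in atTop, s k < Ts + η :=
    (tendsto_order.1 hlim).2 (Ts + η) (by linarith)
  obtain ⟨k, hk⟩ := hev.exists
  refine ⟨k, lt_of_lt_of_le hk (by linarith [min_le_left δ ((c / (|C| + 1)) ^ 2)]), ?_⟩
  obtain ⟨x, hx⟩ := hlow k
  refine ⟨x, lt_of_lt_of_le ?_ hx⟩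
  have hdpos : 0 < s k - Ts := sub_pos.2 (hs k)
  have hdlt : s k - Ts < (c / (|C| + 1)) ^ 2 := by
    have := min_le_right δ ((c / (|C| + 1)) ^ 2)
    linarith
  have hsqrt_lt : Real.sqrt (s k - Ts) < c / (|C| + 1) := by
    calc Real.sqrt (s k - Ts) < Real.sqrt ((c / (|C| + 1)) ^ 2) :=
          Real.sqrt_lt_sqrt hdpos.le hdlt
      _ = c / (|C| + 1) := Real.sqrt_sq (by positivity)
  have hsqrt_pos : 0 < Real.sqrt (s k - Ts) := Real.sqrt_pos.2 hdpos
  calc C ≤ |C| := le_abs_self C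
    _ < |C| + 1 := lt_add_one _
    _ = c / (c / (|C| + 1)) := by field_simp
    _ < c / Real.sqrt (s k - Ts) := by
        exact div_lt_div_of_pos_left hc hsqrt_pos hsqrt_lt

/-- **Two weak solutions from the same smooth datum (Cheskidov–Dai–Palasek 2025, §1: "failure of
uniqueness … directly follow[s]").** For `n ≥ 2` and every smooth divergence-free `u₀` there are
`T > 0` and two weak solutions `u`, `v` on `𝕋ⁿ × [0,T]` with datum `u₀`, both `C^∞(𝕋ⁿ)` at
every `t ∈ [0,T]`, `v` moreover classical on `[0, 3T/4]`, which differ at some time in `(0,T]`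
(take the solutions of Thm. 1.1 with `T_* = T/2` and `T_* = 3T/4`: the second is bounded near
`T/2`, the first blows up there from the right). Proved from the barrier fact.
[cite: CheskidovDaiPalasek2025, §1 (p. 2) and Thm. 1.1] -/
theorem InstantaneousTypeIBlowup.exists_two (h : InstantaneousTypeIBlowup) (hn : 2 ≤ n)
    {u₀ : (𝕋^n) → ℝ^n} (hs : Literature.Analysis.FunctionSpaces.Torus.IsSmooth u₀)
    (hd : Literature.Analysis.FunctionSpaces.Torus.IsDivFree u₀) :
    ∃ T : ℝ, 0 < T ∧ ∃ u v : ℝ → (𝕋^n) → ℝ^n,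
      Literature.Analysis.FunctionSpaces.Torus.IsWeakNSSolutionWithDataOn T 1 u₀ u ∧
      Literature.Analysis.FunctionSpaces.Torus.IsWeakNSSolutionWithDataOn T 1 u₀ v ∧
      (∀ t ∈ Icc 0 T, Literature.Analysis.FunctionSpaces.Torus.IsSmooth (u t)) ∧
      (∀ t ∈ Icc 0 T, Literature.Analysis.FunctionSpaces.Torus.IsSmooth (v t)) ∧
      (∃ p : ℝ → (𝕋^n) → ℝ,
        Literature.Analysis.FunctionSpaces.Torus.IsClassicalNSSolutionOn (Icc 0 (3 * T / 4)) 1 0 v p) ∧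
      ∃ t ∈ Ioc 0 T, u t ≠ v t := by
  obtain ⟨T, hT, hall⟩ := h n hn u₀ hs hd
  -- the solution blowing up from the right at `T/2`
  obtain ⟨u, hu, -, -, -, husm, ⟨c, hc, s, hsI, hslim, hlow⟩, -⟩ :=
    hall (T / 2) (by linarith) (by linarith)
  -- the solution classical on `[0, 3T/4]`
  obtain ⟨v, hv, -, hvcl, -, hvsm, -⟩ := hall (3 * T / 4) (by linarith) (by linarith)
  obtain ⟨p, hp⟩ := hvcl (by linarith)
  obtain ⟨C, hC⟩ := exists_bound_of_isClassicalNSSolutionOn_Icc hp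
  obtain ⟨k, hk, x, hx⟩ := exists_lt_and_lt_norm_of_rightBlowup hc (fun k => (hsI k).1) hslim hlow C (T / 4)
    (by linarith)
  refine ⟨T, hT, u, v, hu, hv, husm, hvsm, ⟨p, hp⟩, s k, ⟨by linarith [(hsI k).1], (hsI k).2⟩, ?_⟩
  intro heq
  have hle : ‖v (s k) x‖ ≤ C := hC (s k) ⟨by linarith [(hsI k).1], by linarith⟩ x
  rw [heq] at hx
  exact absurd hle (not_le.2 hx)

/-- **Non-uniqueness (failure of a uniqueness principle in the formal class).** For `n ≥ 2` and a
smooth divergence-free datum `u₀` it is NOT the case that weak solutions on `𝕋ⁿ × [0,T]` with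
datum `u₀` which are `C^∞(𝕋ⁿ)` at every time `t ∈ [0,T]` are determined by the datum.
[cite: CheskidovDaiPalasek2025, §1 (p. 2) and Thm. 1.1] -/
theorem InstantaneousTypeIBlowup.not_unique (h : InstantaneousTypeIBlowup) (hn : 2 ≤ n)
    {u₀ : (𝕋^n) → ℝ^n} (hs : Literature.Analysis.FunctionSpaces.Torus.IsSmooth u₀)
    (hd : Literature.Analysis.FunctionSpaces.Torus.IsDivFree u₀) :
    ¬ ∀ (T : ℝ) (u v : ℝ → (𝕋^n) → ℝ^n),
        Literature.Analysis.FunctionSpaces.Torus.IsWeakNSSolutionWithDataOn T 1 u₀ u →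
        Literature.Analysis.FunctionSpaces.Torus.IsWeakNSSolutionWithDataOn T 1 u₀ v →
        (∀ t ∈ Icc 0 T, Literature.Analysis.FunctionSpaces.Torus.IsSmooth (u t)) →
        (∀ t ∈ Icc 0 T, Literature.Analysis.FunctionSpaces.Torus.IsSmooth (v t)) →
        ∀ t ∈ Ioc 0 T, u t = v t := by
  intro hall
  obtain ⟨T, -, u, v, hu, hv, husm, hvsm, -, t, ht, hne⟩ := h.exists_two hn hs hd
  exact hne (hall T u v hu hv husm hvsm t ht)

/-- **Failure of weak–strong uniqueness in the formal class (Cheskidov–Dai–Palasek 2025, §1: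
"even weak–strong uniqueness of the initial value problem" fails).** For `n ≥ 2` and a smooth
divergence-free `u₀` it is NOT the case that a weak solution on `𝕋ⁿ × [0,T]` with datum `u₀`,
`C^∞(𝕋ⁿ)` at every time, must agree on `[0,τ]` with a classical solution `v` on `[0,τ]`,
`τ ≤ T`, issued from the same datum (`v 0 = u₀`). [cite: CheskidovDaiPalasek2025, §1 (p. 2) and Thm. 1.1] -/
theorem InstantaneousTypeIBlowup.not_weak_strong_unique (h : InstantaneousTypeIBlowup)
    (hn : 2 ≤ n) {u₀ : (𝕋^n) → ℝ^n} (hs : Literature.Analysis.FunctionSpaces.Torus.IsSmooth u₀)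
    (hd : Literature.Analysis.FunctionSpaces.Torus.IsDivFree u₀) :
    ¬ ∀ (T τ : ℝ) (u v : ℝ → (𝕋^n) → ℝ^n) (p : ℝ → (𝕋^n) → ℝ), 0 < τ → τ ≤ T →
        Literature.Analysis.FunctionSpaces.Torus.IsWeakNSSolutionWithDataOn T 1 u₀ u →
        (∀ t ∈ Icc 0 T, Literature.Analysis.FunctionSpaces.Torus.IsSmooth (u t)) →
        Literature.Analysis.FunctionSpaces.Torus.IsClassicalNSSolutionOn (Icc 0 τ) 1 0 v p →
        v 0 = u₀ → ∀ t ∈ Icc 0 τ, u t = v t := by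
  intro hall
  obtain ⟨T, hT, hfact⟩ := h n hn u₀ hs hd
  obtain ⟨u, hu, -, -, -, husm, ⟨c, hc, s, hsI, hslim, hlow⟩, -⟩ :=
    hfact (T / 2) (by linarith) (by linarith)
  obtain ⟨v, -, hv0, hvcl, -⟩ := hfact (3 * T / 4) (by linarith) (by linarith)
  obtain ⟨p, hp⟩ := hvcl (by linarith)
  obtain ⟨C, hC⟩ := exists_bound_of_isClassicalNSSolutionOn_Icc hp
  obtain ⟨k, hk, x, hx⟩ := exists_lt_and_lt_norm_of_rightBlowup hc (fun k => (hsI k).1) hslim hlow C (T / 4)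
    (by linarith)
  have hmem : s k ∈ Icc 0 (3 * T / 4) := ⟨by linarith [(hsI k).1], by linarith⟩
  have heq := hall T (3 * T / 4) u v p (by linarith) (by linarith) hu husm hp hv0 (s k) hmem
  have hle : ‖v (s k) x‖ ≤ C := hC (s k) hmem x
  rw [heq] at hx
  exact absurd hle (not_le.2 hx)

end Literature.Barriers.NavierStokesRegularity

end
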